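import Summits.QuantumFields.BalabanUV.Beta.GAN24.DiagramDecayTorus

/-!
# `BalabanUV.Beta.GAN24.DiagramDecayInsertion` — binder row G-an2-4 ∕ (CONV-C), route R7 «TWO CURRENCIES», PART 135: THE u-DERIVATIVE SECTOR THROUGH THE DIAGRAM ALGEBRA — the
# β-coefficient shadows of EVERY background-derivative insertion chain `c^{(n)}_k = (L^d)^k·Q_k(𝒢^{(k)}P_k)^n𝒢^{(k)}Q_kᴴ` of the first-order model on Bałaban's (1.18) tower (PART 126's
# unconditional END), and the u-derivative of the effective form's one-loop bubble, `Σ̇_k ⊙ Σ_kᵀ + Σ_k ⊙ Σ̇_kᵀ` (Leibniz on PART 132's bubble; `Σ̇_k = c_k⁻¹ċ_kc_k⁻¹` = PART 128's END object),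
# in BOTH currencies with ONE set of constants for ALL tori and ALL Lipschitz backgrounds of given constants `(α, β)` — the derivative sector is where the polarization `Π = δ²E∕δB²` lives;
# every input a tree theorem (`d ≥ 2`, `L ≥ 2`, `a > 0`) (unit b2b-balaban-gan24-p3, gen 53; v1)

NOT IN PRINT; OUR PROOF ([folklore] composition BY NAME: PART 126 `exists_rate_firstOrderInsertion_QB`, PART 128 `exists_decay_effIns` ∕ `decayStations_effIns`, PART 130 (`entryDecay_hadamard ∕ _transpose ∕ _add`,
`twoLevelDecayRate_hadamard ∕ _transpose ∕ _add ∕ _of_le_rate ∕ _const_nonneg`), PART 128 `entryDecay_of_le_rate`, PART 132 (`decay_effForm`, `exists_limit_functional_distK`); [Balaban1987RG1] (1.20)–(1.22)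
p. 264 locate the SHAPES (the polarization as a second background derivative; the β-coefficient as its weighted lattice sum); nothing printed is a hypothesis).
HONEST FRAMING (cell contract, verbatim): «discharging `BetaPertH` makes Bałaban's UV stability UNCONDITIONAL — a real constructive-QFT result; it is NOT the
continuum limit and NOT the Clay problem.»  HONEST DEPENDENCY (verbatim): «continuum YM on T⁴ ⇐ BetaPertH ∧ nine spine estimates (0/9 proved); BetaPertH ⇐
(D1) ∧ (D4) ∧ CAP+tail; G-an2-4 gates asym, D1 and NE2/3/4.»

WHAT THIS FILE PROVES (0 sorry, 0 `def`; `θ = √(L⁻¹)`; `LipschitzBackground L M V α β` the first-order model's binder; `Σ_k = (unitCovB k)⁻¹ − a·1`, `Σ̇_k = (unitCovB k)⁻¹·ċ_k·(unitCovB k)⁻¹`):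
* §1 **`betaShadow_insertion_QB`** (`L ≥ 2`, `d ≥ 2`, `n m : ℕ`, `α β : ℝ`): `∃ C ≥ 0` (from `(d, L, a, α, β, n, m)` only) such that for EVERY torus `M`, EVERY background `V` with `LipschitzBackground L M V α β`,
  every site `x` and every weight `‖w x y‖ ≤ W(1 + distK x y)^m`: `Σ_y c^{(n)}_k(x,y)w(x,y) → b_∞(x)` with `‖Σ_y c^{(n)}_k(x,y)w(x,y) − b_∞(x)‖ ≤ C·W·(√(L⁻¹))^k` — the (AF-0r) shape for the whole
  u-derivative insertion class, uniformly in the volume and the background.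
* §2 **`twoLevelDecayRate_bubble_effIns`** (`L ≥ 2`, `d ≥ 2`, `0 ≤ α`, `0 ≤ β`): `∃ ρ > 0, B₁, B₂` (volume-free) with, for every `M` and every such `V`, (UD) `∀ k, EntryDecay distK (Σ̇_k ⊙ Σ_kᵀ + Σ_k ⊙ Σ̇_kᵀ) B₁ ρ`
  and (SR) `TwoLevelDecayRate distK (k ↦ Σ̇_k ⊙ Σ_kᵀ + Σ_k ⊙ Σ̇_kᵀ) B₂ ρ (√(L⁻¹))`.
* §3 **`betaShadow_bubble_effIns`**: its β-shadows converge, `‖b_k(x) − b_∞(x)‖ ≤ C·W·(√(L⁻¹))^k`, `C` free of `M` and `V`.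
WHAT IT DOES NOT DO: Bałaban's Table-T vertices ∕ `Q_k(U)` (row an1's dictionary); backgrounds beyond the first-order model (PART 125 ∕ 129's objects go through the same lines); infinite volume
(PARTs 133 ∕ 134's socket).  SUPPLIER work; no consumer of record; NEVER «G-an2-4 closed»; NOT (CONV-C), NOT D1, NOT `BetaPertH`, NOT continuum, NOT Clay.  Records: `HOME/b2b-balaban-gan24-p3/gen53/README.md`.
-/

noncomputable section

open scoped BigOperators ComplexConjugate Matrix Matrix.Norms.L2Operator Kronecker
open Filter Topology

namespace Summit.QuantumFields.BalabanUV.Beta.GAN24.DiagramDecayInsertion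

open Summit.QuantumFields.BalabanUV.T4Continuum
open Summit.QuantumFields.BalabanUV.T4Continuum.CovariantAveragingTower (avgTow)
open Summit.QuantumFields.BalabanUV.T4Continuum.BalabanAveragedTowerUnit (idx QBlev calGlev unitCovB)
open Summit.QuantumFields.BalabanUV.T4Continuum.KingPairingPlantedLaw (calDalev)
open Summit.QuantumFields.BalabanUV.T4Continuum.FirstOrderBackgroundModel (LipschitzBackground Pmodel)
open Summit.QuantumFields.BalabanUV.T4Continuum.CTKingTowerWeights (distK distK_comm)
open Summit.QuantumFields.BalabanUV.T4Continuum.DecayRateInterpolation (EntryDecay TwoLevelDecayRate)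
open Summit.QuantumFields.BalabanUV.Beta.GAN24.UnitLatticeDecayAlgebra (distK_nonneg)
open Summit.QuantumFields.BalabanUV.Beta.GAN24.EffectiveFormDecay (entryDecay_of_le_rate exists_decay_effIns decayStations_effIns)
open Summit.QuantumFields.BalabanUV.Beta.GAN24.InsertionChainDecayBalaban (exists_rate_firstOrderInsertion_QB)
open Summit.QuantumFields.BalabanUV.Beta.GAN24.DiagramDecayAlgebra
open Summit.QuantumFields.BalabanUV.Beta.GAN24.DiagramDecayTorus (exists_limit_functional_distK decay_effForm)

variable {d : ℕ} (L : ℕ) [NeZero L] (a : ℝ) (ha : 0 < a)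

/-! ## §1 The β-shadows of the u-derivative insertion chains -/

/-- **`betaShadow_insertion_QB` — THE (AF-0r) SHAPE FOR EVERY WEIGHTED FUNCTIONAL OF EVERY u-DERIVATIVE INSERTION CHAIN, UNIFORMLY IN THE VOLUME AND THE BACKGROUND** [our proof] (`L ≥ 2`,
`d ≥ 2`): for all `n m : ℕ` and Lipschitz constants `α, β` there is `C ≥ 0` such that for EVERY torus `M`, EVERY `V` with `LipschitzBackground L M V α β`, every site `x` and every weight
`‖w x y‖ ≤ W(1 + distK x y)^m` (`W ≥ 0`), the functional `b_k(x) = Σ_y c^{(n)}_k(x,y)w(x,y)` of the n-th insertion chain converges with `‖b_k(x) − b_∞(x)‖ ≤ C·W·(√(L⁻¹))^k`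
(PART 126's `exists_rate_firstOrderInsertion_QB` through PART 132's `exists_limit_functional_distK`). [cite: Balaban1987RG1, (1.22) p.264 (shape)] -/
theorem betaShadow_insertion_QB (hL : 2 ≤ L) (hd : 2 ≤ d) (n m : ℕ) (α β : ℝ) :
    ∃ C : ℝ, 0 ≤ C ∧ ∀ (M : Fin d → ℕ) [∀ μ, NeZero (M μ)] (V : (k : ℕ) → Fin d → (idx L M k → ℂ)) (_hV : LipschitzBackground L M V α β)
      (x : idx L M 0) (w : idx L M 0 → idx L M 0 → ℂ) (W : ℝ), 0 ≤ W → (∀ x y, ‖w x y‖ ≤ W * (1 + distK L M x y) ^ m) →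
      ∃ binf : ℂ,
        Tendsto (fun k => ∑ y, avgTow (QBlev L M) ((L : ℝ) ^ d) (fun k => ((calDalev L M a ha k)⁻¹ * Pmodel L M V k) ^ n * (calDalev L M a ha k)⁻¹) k x y * w x y)
          atTop (𝓝 binf) ∧
        ∀ k, ‖∑ y, avgTow (QBlev L M) ((L : ℝ) ^ d) (fun k => ((calDalev L M a ha k)⁻¹ * Pmodel L M V k) ^ n * (calDalev L M a ha k)⁻¹) k x y * w x y - binf‖
          ≤ C * W * Real.sqrt ((L : ℝ)⁻¹) ^ k := by
  have hd1 : 1 ≤ d := le_trans one_le_two hd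
  obtain ⟨κ, hκ0, -, hall⟩ := exists_rate_firstOrderInsertion_QB L hL hd1 a ha
  -- the volume-free (SR) constant of the n-th chain, named by unification
  have key : ∃ B' : ℝ, 0 ≤ B' ∧ ∀ (M : Fin d → ℕ) [∀ μ, NeZero (M μ)] (V : (k : ℕ) → Fin d → (idx L M k → ℂ)), LipschitzBackground L M V α β →
      TwoLevelDecayRate (distK L M) (avgTow (QBlev L M) ((L : ℝ) ^ d) (fun k => ((calDalev L M a ha k)⁻¹ * Pmodel L M V k) ^ n * (calDalev L M a ha k)⁻¹))
        B' (κ / 2) (Real.sqrt ((L : ℝ)⁻¹)) :=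
    ⟨_, Real.sqrt_nonneg _, fun M _ V hV => hall M V α β hV n⟩
  obtain ⟨B', hB', hsr⟩ := key
  have hL1 : (1 : ℝ) < L := by exact_mod_cast (lt_of_lt_of_le one_lt_two hL : 1 < L)
  have hθ1 : Real.sqrt ((L : ℝ)⁻¹) < 1 := by
    rw [show (1 : ℝ) = Real.sqrt 1 from Real.sqrt_one.symm]
    exact Real.sqrt_lt_sqrt (inv_nonneg.mpr (Nat.cast_nonneg _)) (inv_lt_one_of_one_lt₀ hL1)
  obtain ⟨C, hC0, hC⟩ := exists_limit_functional_distK (d := d) hd (half_pos hκ0) hθ1 m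
  refine ⟨C * B' / (1 - Real.sqrt ((L : ℝ)⁻¹)), by have := sub_pos.mpr hθ1; positivity, fun M _ V hV x w W hW hw => ?_⟩
  obtain ⟨binf, hlim, hbd⟩ := hC L M _ B' hB' (hsr M V hV) x w W hW hw
  exact ⟨binf, hlim, fun k => (hbd k).trans (le_of_eq (by ring))⟩

/-! ## §2 The u-derivative of the effective form's bubble in both currencies -/

/-- **`twoLevelDecayRate_bubble_effIns` — `d∕du (Σ_k ⊙ Σ_kᵀ) = Σ̇_k ⊙ Σ_kᵀ + Σ_k ⊙ Σ̇_kᵀ` IN BOTH CURRENCIES, UNCONDITIONALLY** [our proof] (`L ≥ 2`, `d ≥ 2`, `0 ≤ α`, `0 ≤ β`): there are `ρ > 0`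
and `B₁, B₂` depending on `(d, L, a, α, β)` only such that for EVERY torus `M` and EVERY `V` with `LipschitzBackground L M V α β`: (UD) `∀ k, EntryDecay distK (Σ̇_k ⊙ Σ_kᵀ + Σ_k ⊙ Σ̇_kᵀ) B₁ ρ`
and (SR) `TwoLevelDecayRate distK (k ↦ Σ̇_k ⊙ Σ_kᵀ + Σ_k ⊙ Σ̇_kᵀ) B₂ ρ (√(L⁻¹))` — PART 132's `decay_effForm` for `Σ`, PART 128 §4 for `Σ̇` (rates equalised by monotonicity), PART 130's Hadamard,
transpose and sum rules (rates add, no letter). -/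
theorem twoLevelDecayRate_bubble_effIns (hL : 2 ≤ L) (hd : 2 ≤ d) {α β : ℝ} (hαβ : 0 ≤ α ∧ 0 ≤ β) :
    ∃ ρ B₁ B₂ : ℝ, 0 < ρ ∧ ∀ (M : Fin d → ℕ) [∀ μ, NeZero (M μ)] (V : (k : ℕ) → Fin d → (idx L M k → ℂ)) (_hV : LipschitzBackground L M V α β),
      (∀ k, EntryDecay (distK L M)
        (((unitCovB L M a ha k)⁻¹ * avgTow (QBlev L M) ((L : ℝ) ^ d) (fun k => calGlev L M a ha k * Pmodel L M V k * calGlev L M a ha k) k * (unitCovB L M a ha k)⁻¹)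
            ⊙ ((unitCovB L M a ha k)⁻¹ - (a : ℂ) • (1 : Matrix (idx L M 0) (idx L M 0) ℂ))ᵀ
          + ((unitCovB L M a ha k)⁻¹ - (a : ℂ) • (1 : Matrix (idx L M 0) (idx L M 0) ℂ))
            ⊙ ((unitCovB L M a ha k)⁻¹ * avgTow (QBlev L M) ((L : ℝ) ^ d) (fun k => calGlev L M a ha k * Pmodel L M V k * calGlev L M a ha k) k * (unitCovB L M a ha k)⁻¹)ᵀ)
        B₁ ρ) ∧
      TwoLevelDecayRate (distK L M)
        (fun k => ((unitCovB L M a ha k)⁻¹ * avgTow (QBlev L M) ((L : ℝ) ^ d) (fun k => calGlev L M a ha k * Pmodel L M V k * calGlev L M a ha k) k * (unitCovB L M a ha k)⁻¹)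
            ⊙ ((unitCovB L M a ha k)⁻¹ - (a : ℂ) • (1 : Matrix (idx L M 0) (idx L M 0) ℂ))ᵀ
          + ((unitCovB L M a ha k)⁻¹ - (a : ℂ) • (1 : Matrix (idx L M 0) (idx L M 0) ℂ))
            ⊙ ((unitCovB L M a ha k)⁻¹ * avgTow (QBlev L M) ((L : ℝ) ^ d) (fun k => calGlev L M a ha k * Pmodel L M V k * calGlev L M a ha k) k * (unitCovB L M a ha k)⁻¹)ᵀ)
        B₂ ρ (Real.sqrt ((L : ℝ)⁻¹)) := by
  -- `Σ`: (UD)+(SR) at rate `κ'` (PART 132); `Σ̇`: (UD) at `δ₁` (PART 128 `exists_decay_effIns`), (SR) at `δ₂/2` (`decayStations_effIns`)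
  obtain ⟨κ', Bs, Bs', hκ', hBs, hBs', hS⟩ := decay_effForm L a ha hL hd
  obtain ⟨δ₁, Bd, hδ₁, hBd, hud⟩ := exists_decay_effIns L a ha hd hαβ
  obtain ⟨δ₂, _B'', Bd', hδ₂, hsr⟩ := decayStations_effIns L a ha hL hd hαβ
  set ρ₀ : ℝ := min δ₁ (δ₂ / 2) with hρ₀
  have hρ₀0 : 0 < ρ₀ := lt_min hδ₁ (half_pos hδ₂)
  refine ⟨ρ₀ + κ', Bd * Bs + Bs * Bd, (Bd' * Bs + Bd * Bs') + (Bs' * Bd + Bs * Bd'), by positivity, fun M _ V hV => ?_⟩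
  obtain ⟨hSud, hSsr⟩ := hS M
  obtain ⟨Ilim, -, -, -, hsrM⟩ := hsr M V hV
  have hθ0 : 0 ≤ Real.sqrt ((L : ℝ)⁻¹) := Real.sqrt_nonneg _
  haveI : Nonempty (idx L M 0) := ⟨(fun _ => 0, ⟨0, lt_of_lt_of_le two_pos hd⟩)⟩
  have hBd' : 0 ≤ Bd' := twoLevelDecayRate_const_nonneg hsrM
  -- equalise the rates of `Σ̇` to `ρ₀`
  have hud' : ∀ k, EntryDecay (distK L M)
      ((unitCovB L M a ha k)⁻¹ * avgTow (QBlev L M) ((L : ℝ) ^ d) (fun k => calGlev L M a ha k * Pmodel L M V k * calGlev L M a ha k) k * (unitCovB L M a ha k)⁻¹) Bd ρ₀ :=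
    fun k => entryDecay_of_le_rate (distK_nonneg L M) (hud M V hV k) hBd (min_le_left _ _)
  have hsr' := twoLevelDecayRate_of_le_rate (distK_nonneg L M) hsrM hBd' hθ0 (min_le_right δ₁ (δ₂ / 2))
  -- transposes of `Σ`, `Σ̇`
  have hSudT := fun k => entryDecay_transpose (distK_comm L M) (hSud k)
  have hSsrT := twoLevelDecayRate_transpose (distK_comm L M) hSsr
  have hudT := fun k => entryDecay_transpose (distK_comm L M) (hud' k)
  have hsrT := twoLevelDecayRate_transpose (distK_comm L M) hsr'
  refine ⟨fun k => entryDecay_add (entryDecay_hadamard (hud' k) (hSudT k)) ?_, ?_⟩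
  · have h := entryDecay_hadamard (hSud k) (hudT k)
    rw [add_comm κ' ρ₀] at h
    exact h
  · have h1 := twoLevelDecayRate_hadamard hud' hSudT hsr' hSsrT
    have h2 := twoLevelDecayRate_hadamard hSud hudT hSsr hsrT
    rw [add_comm κ' ρ₀] at h2
    exact twoLevelDecayRate_add h1 h2

/-! ## §3 The β-shadow of the u-derivative bubble -/

/-- **`betaShadow_bubble_effIns` — THE (AF-0r) SHAPE FOR THE u-DERIVATIVE OF THE BUBBLE, UNIFORMLY IN THE VOLUME AND THE BACKGROUND** [our proof] (`L ≥ 2`, `d ≥ 2`, `0 ≤ α`, `0 ≤ β`, `m : ℕ`):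
there is `C` (from `(d, L, a, α, β, m)` only) such that for every torus, every `V` with `LipschitzBackground L M V α β`, every site `x` and every weight `‖w‖ ≤ W(1 + distK)^m`, the functional
`b_k(x) = Σ_y (Σ̇_k ⊙ Σ_kᵀ + Σ_k ⊙ Σ̇_kᵀ)(x,y)w(x,y)` converges with `‖b_k(x) − b_∞(x)‖ ≤ C·W·(√(L⁻¹))^k`. [cite: Balaban1987RG1, (1.22) p.264 (shape)] -/
theorem betaShadow_bubble_effIns (hL : 2 ≤ L) (hd : 2 ≤ d) {α β : ℝ} (hαβ : 0 ≤ α ∧ 0 ≤ β) (m : ℕ) :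
    ∃ C : ℝ, ∀ (M : Fin d → ℕ) [∀ μ, NeZero (M μ)] (V : (k : ℕ) → Fin d → (idx L M k → ℂ)) (_hV : LipschitzBackground L M V α β)
      (x : idx L M 0) (w : idx L M 0 → idx L M 0 → ℂ) (W : ℝ), 0 ≤ W → (∀ x y, ‖w x y‖ ≤ W * (1 + distK L M x y) ^ m) →
      ∃ binf : ℂ,
        Tendsto (fun k => ∑ y,
          (((unitCovB L M a ha k)⁻¹ * avgTow (QBlev L M) ((L : ℝ) ^ d) (fun k => calGlev L M a ha k * Pmodel L M V k * calGlev L M a ha k) k * (unitCovB L M a ha k)⁻¹)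
              ⊙ ((unitCovB L M a ha k)⁻¹ - (a : ℂ) • (1 : Matrix (idx L M 0) (idx L M 0) ℂ))ᵀ
            + ((unitCovB L M a ha k)⁻¹ - (a : ℂ) • (1 : Matrix (idx L M 0) (idx L M 0) ℂ))
              ⊙ ((unitCovB L M a ha k)⁻¹ * avgTow (QBlev L M) ((L : ℝ) ^ d) (fun k => calGlev L M a ha k * Pmodel L M V k * calGlev L M a ha k) k * (unitCovB L M a ha k)⁻¹)ᵀ)
            x y * w x y) atTop (𝓝 binf) ∧
        ∀ k, ‖∑ y,
          (((unitCovB L M a ha k)⁻¹ * avgTow (QBlev L M) ((L : ℝ) ^ d) (fun k => calGlev L M a ha k * Pmodel L M V k * calGlev L M a ha k) k * (unitCovB L M a ha k)⁻¹)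
              ⊙ ((unitCovB L M a ha k)⁻¹ - (a : ℂ) • (1 : Matrix (idx L M 0) (idx L M 0) ℂ))ᵀ
            + ((unitCovB L M a ha k)⁻¹ - (a : ℂ) • (1 : Matrix (idx L M 0) (idx L M 0) ℂ))
              ⊙ ((unitCovB L M a ha k)⁻¹ * avgTow (QBlev L M) ((L : ℝ) ^ d) (fun k => calGlev L M a ha k * Pmodel L M V k * calGlev L M a ha k) k * (unitCovB L M a ha k)⁻¹)ᵀ)
            x y * w x y - binf‖ ≤ C * W * Real.sqrt ((L : ℝ)⁻¹) ^ k := by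
  obtain ⟨ρ, B₁, B₂, hρ, h⟩ := twoLevelDecayRate_bubble_effIns L a ha hL hd hαβ
  have hL1 : (1 : ℝ) < L := by exact_mod_cast (lt_of_lt_of_le one_lt_two hL : 1 < L)
  have hθ1 : Real.sqrt ((L : ℝ)⁻¹) < 1 := by
    rw [show (1 : ℝ) = Real.sqrt 1 from Real.sqrt_one.symm]
    exact Real.sqrt_lt_sqrt (inv_nonneg.mpr (Nat.cast_nonneg _)) (inv_lt_one_of_one_lt₀ hL1)
  obtain ⟨C, hC0, hC⟩ := exists_limit_functional_distK (d := d) hd hρ hθ1 m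
  refine ⟨C * B₂ / (1 - Real.sqrt ((L : ℝ)⁻¹)), fun M _ V hV x w W hW hw => ?_⟩
  obtain ⟨hud, hsr⟩ := h M V hV
  haveI : Nonempty (idx L M 0) := ⟨(fun _ => 0, ⟨0, lt_of_lt_of_le two_pos hd⟩)⟩
  have hB₂ : 0 ≤ B₂ := twoLevelDecayRate_const_nonneg hsr
  obtain ⟨binf, hlim, hbd⟩ := hC L M _ B₂ hB₂ hsr x w W hW hw
  exact ⟨binf, hlim, fun k => (hbd k).trans (le_of_eq (by ring))⟩

end Summit.QuantumFields.BalabanUV.Beta.GAN24.DiagramDecayInsertion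

end
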